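import Mathlib
import HarnessLib
import Literature.NumberTheory.DiophantineGeometry.MultiplicativeGroupApproximationMinkowskiProofs

/-!
# The Subspace Theorem over `ℚ` — II. Successive minima of a parallelepiped w.r.t. a sublattice

Second file towards the `p`-adic Subspace Theorem over `ℚ` (Bombieri–Gubler, *Heights in
Diophantine Geometry*, §7.5, specialised to `K = ℚ`; see `SubspaceLattices.lean` for the setting).
For `K = ℚ` the adelic approximation domain `Π(Q)` of B–G 7.5.6 is the pair consisting of
* the archimedean parallelepiped `{ξ ∈ ℝ^N : ‖A ξ‖_∞ ≤ 1}` of a real `N × N` matrix `A` with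
  `det A ≠ 0` (in the application `A = diag(Q^{-c_{∞,i}}) L`), i.e. the unit ball of the norm
  `ξ ↦ ‖A ξ‖_∞`, and
* a subgroup `Λ ≤ ℤ^N` of finite index (the congruence lattice of `SubspaceLattices.lean`),
and its successive minima are those of this norm with respect to `Λ`. This file provides the
two halves of **Minkowski's second theorem** in this setting (B–G Thm. C.2.11 as used in 7.5.12,
7.5.30–7.5.32), transported from the tree's `ℤ^q`-versions
(`Dioph.exists_directional_system_prod_mul_volume_le`, after Tao–Vu / Evertse–Győry):

* `exists_basisMatrix` — a subgroup `Λ ≤ ℤ^N` of finite index is `W ℤ^N` for an integer matrix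
  `W` with `|det W| = [ℤ^N : Λ]` [folklore; Smith normal form];
* `exists_directional_prod_le` (upper bound) — there are linearly independent
  `v₀, …, v_{N-1} ∈ Λ`, `‖A v₀‖ ≤ ⋯ ≤ ‖A v_{N-1}‖`, every `z ∈ Λ` with `‖A z‖ < ‖A v_k‖` lying in
  the real span of `v₀, …, v_{k-1}` (so `‖A v_k‖ = λ_{k+1}`, the successive minima), with
  `∏_k ‖A v_k‖ ≤ |det A| · [ℤ^N : Λ]`;
* `det_mul_index_le_prod` (lower bound) — for ANY linearly independent `w₀, …, w_{N-1} ∈ Λ`,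
  `|det A| · [ℤ^N : Λ] ≤ N! ∏_k ‖A w_k‖` (permutation expansion of `det (A W)`).

## References
* [BombieriGubler2006] E. Bombieri, W. Gubler, *Heights in Diophantine Geometry*, CUP 2006,
  Thm. C.2.11, §7.5 (7.5.6, 7.5.12, 7.5.30).
* [EvertseGyory2015] J.-H. Evertse, K. Győry, *Unit Equations in Diophantine Number Theory*,
  CUP 2015, Thm. 4.3.1.
-/

noncomputable section

open Finset Matrix MeasureTheory Module

namespace Literature.NumberTheory.DiophantineApproximation.Subspace

open Literature.NumberTheory.DiophantineGeometry.Dioph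

variable {N : ℕ}

/-! ### A basis matrix for a subgroup of finite index of `ℤ^N` -/

/-- A subgroup of finite index of `ℤ^N` has rank `N`. [folklore] -/
theorem finrank_toIntSubmodule_eq (Λ : AddSubgroup (Fin N → ℤ)) (hΛ : Λ.index ≠ 0) :
    finrank ℤ Λ.toIntSubmodule = N := by
  apply le_antisymm
  · simpa using Submodule.finrank_le Λ.toIntSubmodule
  · -- `x ↦ [ℤ^N : Λ] • x` is an injective linear map into `Λ`
    let f : (Fin N → ℤ) →ₗ[ℤ] Λ.toIntSubmodule :=
      { toFun := fun x => ⟨Λ.index • x, Λ.nsmul_index_mem x⟩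
        map_add' := fun x y => by
          apply Subtype.ext
          change Λ.index • (x + y) = Λ.index • x + Λ.index • y
          exact smul_add _ _ _
        map_smul' := fun c x => by
          apply Subtype.ext
          change Λ.index • (c • x) = c • (Λ.index • x)
          exact smul_comm _ _ _ }
    have hf : Function.Injective f := by
      intro x y hxy
      have h : Λ.index • x = Λ.index • y := congrArg Subtype.val hxy
      exact smul_right_injective (Fin N → ℤ) hΛ h
    simpa using LinearMap.finrank_le_finrank_of_injective hf

/-- **Basis matrix.** A subgroup `Λ ≤ ℤ^N` of finite index is the image `W ℤ^N` of an integer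
matrix `W` with `|det W| = [ℤ^N : Λ]` (the columns of `W` are a `ℤ`-basis of `Λ`).
[folklore] -/
theorem exists_basisMatrix (Λ : AddSubgroup (Fin N → ℤ)) (hΛ : Λ.index ≠ 0) :
    ∃ W : Matrix (Fin N) (Fin N) ℤ, (∀ y, W *ᵥ y ∈ Λ) ∧ (∀ x ∈ Λ, ∃ y, W *ᵥ y = x) ∧
      W.det.natAbs = Λ.index := by
  classical
  let b : Basis (Fin N) ℤ Λ.toIntSubmodule :=
    Module.finBasisOfFinrankEq ℤ Λ.toIntSubmodule (finrank_toIntSubmodule_eq Λ hΛ)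
  let W : Matrix (Fin N) (Fin N) ℤ := fun i j => (b j : Fin N → ℤ) i
  have hW : ∀ y : Fin N → ℤ, W *ᵥ y = ((∑ j, y j • b j : Λ.toIntSubmodule) : Fin N → ℤ) := by
    intro y
    ext i
    simp only [mulVec, dotProduct, W]
    rw [AddSubmonoidClass.coe_finsetSum]
    simp only [SetLike.val_smul, Finset.sum_apply, Pi.smul_apply, smul_eq_mul]
    exact Finset.sum_congr rfl fun j _ => mul_comm _ _
  refine ⟨W, fun y => ?_, fun x hx => ?_, ?_⟩
  · rw [hW]; exact SetLike.coe_mem _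
  · refine ⟨fun j => b.repr ⟨x, hx⟩ j, ?_⟩
    rw [hW]
    have := b.sum_repr ⟨x, hx⟩
    exact congrArg Subtype.val this
  · rw [AddSubgroup.index_eq_natAbs_det (Pi.basisFun ℤ (Fin N)) Λ b, Basis.det_apply]
    congr 2

/-! ### Casting integer vectors and matrices to `ℝ` -/

/-- The real vector underlying an integer vector. [folklore] -/
abbrev castVec (z : Fin N → ℤ) : Fin N → ℝ := fun i => (z i : ℝ)

/-- `castVec` is additive. [folklore] -/
theorem castVec_add (x y : Fin N → ℤ) : castVec (x + y) = castVec x + castVec y := by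
  ext i; simp [castVec]

/-- Casting commutes with matrix–vector products. [folklore] -/
theorem castVec_mulVec (W : Matrix (Fin N) (Fin N) ℤ) (y : Fin N → ℤ) :
    castVec (W *ᵥ y) = W.map (Int.cast : ℤ → ℝ) *ᵥ castVec y := by
  ext i
  simp [castVec, mulVec, dotProduct, Matrix.map_apply]

/-- The norm `ξ ↦ ‖A ξ‖_∞` (the gauge of the parallelepiped `{‖A ξ‖_∞ ≤ 1}`) as a seminorm.
[cite: BombieriGubler2006, 7.5.6] -/
abbrev gaugeSeminorm (A : Matrix (Fin N) (Fin N) ℝ) : Seminorm ℝ (Fin N → ℝ) :=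
  (normSeminorm ℝ (Fin N → ℝ)).comp (Matrix.toLin' A)

/-- `gaugeSeminorm A ξ = ‖A ξ‖`. [folklore] -/
theorem gaugeSeminorm_apply (A : Matrix (Fin N) (Fin N) ℝ) (ξ : Fin N → ℝ) :
    gaugeSeminorm A ξ = ‖A *ᵥ ξ‖ := by
  simp [Seminorm.comp_apply]

/-- For `det A ≠ 0` the gauge is a norm (definite). [folklore] -/
theorem gaugeSeminorm_eq_zero (A : Matrix (Fin N) (Fin N) ℝ) (hA : A.det ≠ 0) (ξ : Fin N → ℝ)
    (h : gaugeSeminorm A ξ = 0) : ξ = 0 := by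
  rw [gaugeSeminorm_apply, norm_eq_zero] at h
  have hinj : Function.Injective (Matrix.toLin' A) :=
    Matrix.mulVec_injective_iff_isUnit.mpr ((Matrix.isUnit_iff_isUnit_det _).mpr hA.isUnit)
  exact hinj (by simpa using h)

/-- The unit ball `{‖A ξ‖ < 1}` of the gauge has volume `2^N / |det A|`. [folklore] -/
theorem volume_gauge_lt_one (A : Matrix (Fin N) (Fin N) ℝ) (hA : A.det ≠ 0) :
    volume {ξ : Fin N → ℝ | gaugeSeminorm A ξ < 1} =
      ENNReal.ofReal |A.det⁻¹| * ENNReal.ofReal ((2 : ℝ) ^ N) := by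
  have hset : {ξ : Fin N → ℝ | gaugeSeminorm A ξ < 1} = Matrix.toLin' A ⁻¹' Metric.ball 0 1 := by
    ext ξ
    simp [Matrix.toLin'_apply]
  have hdet : LinearMap.det (Matrix.toLin' A) ≠ 0 := by rwa [LinearMap.det_toLin']
  rw [hset, MeasureTheory.Measure.addHaar_preimage_linearMap volume hdet, LinearMap.det_toLin',
    Real.volume_pi_ball 0 one_pos]
  simp

/-! ### Minkowski's second theorem, upper bound, for `(‖A ·‖, Λ)` -/

/-- **Minkowski's second theorem (upper bound) for the gauge `‖A ·‖_∞` and a subgroup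
`Λ ≤ ℤ^N` of finite index**, existence form: there is a *directional system* `v₀, …, v_{N-1}`
of `Λ` — linearly independent, `‖A v₀‖ ≤ ⋯ ≤ ‖A v_{N-1}‖`, and every `z ∈ Λ` with
`‖A z‖ < ‖A v_k‖` in the real span of `v₀, …, v_{k-1}` (so `‖A v_k‖ = λ_{k+1}`, the successive
minima of the parallelepiped `{‖A ξ‖ ≤ 1}` w.r.t. `Λ`) — with
`∏_k ‖A v_k‖ ≤ |det A| · [ℤ^N : Λ]` (`= 2^N covol(Λ)/vol{‖Aξ‖ ≤ 1}`). Transport of the tree's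
`Dioph.exists_directional_system_prod_mul_volume_le` by a basis matrix of `Λ`.
[cite: BombieriGubler2006, Thm. C.2.11] -/
theorem exists_directional_prod_le (hN : 0 < N) (A : Matrix (Fin N) (Fin N) ℝ) (hA : A.det ≠ 0)
    (Λ : AddSubgroup (Fin N → ℤ)) (hΛ : Λ.index ≠ 0) :
    ∃ v : Fin N → Fin N → ℤ, (∀ k, v k ∈ Λ) ∧
      LinearIndependent ℝ (fun k => castVec (v k)) ∧
      Monotone (fun k => ‖A *ᵥ castVec (v k)‖) ∧
      (∀ k : Fin N, ∀ z ∈ Λ, ‖A *ᵥ castVec z‖ < ‖A *ᵥ castVec (v k)‖ →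
        castVec z ∈ Submodule.span ℝ ((fun k => castVec (v k)) '' {l | l < k})) ∧
      ∏ k, ‖A *ᵥ castVec (v k)‖ ≤ |A.det| * Λ.index := by
  classical
  obtain ⟨W, hWmem, hWsurj, hWdet⟩ := exists_basisMatrix Λ hΛ
  set Wr : Matrix (Fin N) (Fin N) ℝ := W.map (Int.cast : ℤ → ℝ) with hWr
  have hWrdet : Wr.det = (W.det : ℝ) := by rw [hWr, Int.cast_det]
  have hWdet' : |Wr.det| = (Λ.index : ℝ) := by
    rw [hWrdet, ← Int.cast_abs, Int.abs_eq_natAbs, hWdet]; push_cast; rfl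
  have hWr0 : Wr.det ≠ 0 := by
    rw [ne_eq, ← abs_eq_zero, hWdet']; exact_mod_cast hΛ
  have hAW : (A * Wr).det ≠ 0 := by rw [det_mul]; exact mul_ne_zero hA hWr0
  -- the transported norm `y ↦ ‖A W y‖`
  let N' : Seminorm ℝ (Fin N → ℝ) := gaugeSeminorm (A * Wr)
  have N'_apply : ∀ y, N' y = ‖A *ᵥ (Wr *ᵥ y)‖ := fun y => by
    rw [show N' y = ‖(A * Wr) *ᵥ y‖ from gaugeSeminorm_apply _ _, ← mulVec_mulVec]
  obtain ⟨u, hli, hmono, hdir, hvol⟩ :=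
    exists_directional_system_prod_mul_volume_le hN N' (gaugeSeminorm_eq_zero _ hAW)
  -- the directional system of `Λ`
  let v : Fin N → Fin N → ℤ := fun k => W *ᵥ u k
  have hv : ∀ k, castVec (v k) = Wr *ᵥ castVec (u k) := fun k => castVec_mulVec W (u k)
  have hnorm : ∀ k, ‖A *ᵥ castVec (v k)‖ = N' (castVec (u k)) := fun k => by
    rw [N'_apply, hv]
  have hTinj : Function.Injective (Matrix.toLin' Wr) :=
    Matrix.mulVec_injective_iff_isUnit.mpr ((Matrix.isUnit_iff_isUnit_det _).mpr hWr0.isUnit)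
  refine ⟨v, fun k => hWmem _, ?_, ?_, ?_, ?_⟩
  · -- linear independence
    have : (fun k => castVec (v k)) = Matrix.toLin' Wr ∘ fun k => castVec (u k) := by
      funext k; rw [Function.comp_apply, Matrix.toLin'_apply, hv]
    rw [this]
    exact hli.map' _ (LinearMap.ker_eq_bot.mpr hTinj)
  · -- monotonicity
    intro k l hkl
    simp only [hnorm]
    exact hmono hkl
  · -- the directional property
    intro k z hz hlt
    obtain ⟨y, rfl⟩ := hWsurj z hz
    rw [castVec_mulVec, ← hWr, ← N'_apply, hnorm] at hlt
    have hmem := hdir k y hlt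
    have himg : (fun k => castVec (v k)) '' {l | l < k} =
        Matrix.toLin' Wr '' ((fun k => castVec (u k)) '' {l | l < k}) := by
      rw [Set.image_image]
      refine Set.image_congr fun l _ => ?_
      rw [Matrix.toLin'_apply, hv]
    rw [himg, Submodule.span_image, castVec_mulVec, ← hWr]
    exact Submodule.mem_map_of_mem (f := Matrix.toLin' Wr) hmem
  · -- the product bound, from the volume computation
    rw [volume_gauge_lt_one _ hAW] at hvol
    have hP0 : 0 ≤ ∏ k, N' (castVec (u k)) := Finset.prod_nonneg fun k _ => apply_nonneg _ _
    have h2 : (2 : ENNReal) ^ N = ENNReal.ofReal ((2 : ℝ) ^ N) := by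
      rw [ENNReal.ofReal_pow (by norm_num : (0 : ℝ) ≤ 2), ENNReal.ofReal_ofNat]
    rw [h2, ← ENNReal.ofReal_mul (abs_nonneg _), ← ENNReal.ofReal_mul hP0,
      ENNReal.ofReal_le_ofReal_iff (by positivity)] at hvol
    have hd : 0 < |(A * Wr).det| := abs_pos.mpr hAW
    have hprod : ∏ k, N' (castVec (u k)) ≤ |(A * Wr).det| := by
      rw [abs_inv] at hvol
      have h3 : (∏ k, N' (castVec (u k))) * |(A * Wr).det|⁻¹ ≤ 1 := by
        by_contra hcon
        push Not at hcon
        have : (2 : ℝ) ^ N < (∏ k, N' (castVec (u k))) * |(A * Wr).det|⁻¹ * 2 ^ N :=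
          lt_mul_left (by positivity) hcon
        linarith
      rwa [mul_inv_le_iff₀ hd, one_mul] at h3
    calc ∏ k, ‖A *ᵥ castVec (v k)‖ = ∏ k, N' (castVec (u k)) :=
          Finset.prod_congr rfl fun k _ => hnorm k
      _ ≤ |(A * Wr).det| := hprod
      _ = |A.det| * Λ.index := by rw [det_mul, abs_mul, hWdet']

/-! ### Minkowski's second theorem, lower bound, for `(‖A ·‖, Λ)` -/

/-- Permutation expansion bound: `|det (A W)| ≤ N! ∏_k ‖A w_k‖_∞`, where the `w_k` are the
columns of `W`. [folklore] -/
theorem abs_det_mul_le_factorial_mul_prod (A W : Matrix (Fin N) (Fin N) ℝ) :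
    |(A * W).det| ≤ N.factorial * ∏ k, ‖A *ᵥ fun i => W i k‖ := by
  rw [det_apply']
  refine (Finset.abs_sum_le_sum_abs _ _).trans ?_
  have hterm : ∀ σ : Equiv.Perm (Fin N),
      |(Equiv.Perm.sign σ : ℝ) * ∏ k, (A * W) (σ k) k| ≤ ∏ k, ‖A *ᵥ fun i => W i k‖ := by
    intro σ
    rw [abs_mul]
    have hsign : |(Equiv.Perm.sign σ : ℝ)| = 1 := by
      rcases Int.units_eq_one_or (Equiv.Perm.sign σ) with h | h <;> simp [h]
    rw [hsign, one_mul, Finset.abs_prod]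
    refine Finset.prod_le_prod (fun k _ => abs_nonneg _) fun k _ => ?_
    have : (A * W) (σ k) k = (A *ᵥ fun i => W i k) (σ k) := by
      simp [mul_apply, mulVec, dotProduct]
    rw [this, ← Real.norm_eq_abs]
    exact norm_le_pi_norm _ _
  calc ∑ σ : Equiv.Perm (Fin N), |(Equiv.Perm.sign σ : ℝ) * ∏ k, (A * W) (σ k) k|
      ≤ ∑ _σ : Equiv.Perm (Fin N), ∏ k, ‖A *ᵥ fun i => W i k‖ := Finset.sum_le_sum fun σ _ => hterm σ
    _ = N.factorial * ∏ k, ‖A *ᵥ fun i => W i k‖ := by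
      rw [Finset.sum_const, Finset.card_univ, Fintype.card_perm, Fintype.card_fin, nsmul_eq_mul]

/-- **Minkowski's second theorem (lower bound) for the gauge `‖A ·‖_∞` and a subgroup
`Λ ≤ ℤ^N` of finite index**: for ANY `N` linearly independent `w₀, …, w_{N-1} ∈ Λ`,
`|det A| · [ℤ^N : Λ] ≤ N! · ∏_k ‖A w_k‖`. (The `w_k` span a subgroup of `Λ` of index
`|det (w_k)| ≥ [ℤ^N : Λ]`, and `|det A| |det (w_k)| = |det (A w_k)| ≤ N! ∏ ‖A w_k‖`.)
[cite: BombieriGubler2006, Thm. C.2.11] -/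
theorem det_mul_index_le_prod (A : Matrix (Fin N) (Fin N) ℝ) (Λ : AddSubgroup (Fin N → ℤ))
    (hΛ : Λ.index ≠ 0) (w : Fin N → Fin N → ℤ) (hw : ∀ k, w k ∈ Λ)
    (hli : LinearIndependent ℝ (fun k => castVec (w k))) :
    |A.det| * Λ.index ≤ N.factorial * ∏ k, ‖A *ᵥ castVec (w k)‖ := by
  classical
  obtain ⟨W, _hWmem, hWsurj, hWdet⟩ := exists_basisMatrix Λ hΛ
  -- `w_k = W y_k`
  have hy : ∀ k, ∃ y, W *ᵥ y = w k := fun k => hWsurj _ (hw k)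
  choose y hy using hy
  let Y : Matrix (Fin N) (Fin N) ℤ := fun i k => y k i
  let Wm : Matrix (Fin N) (Fin N) ℤ := fun i k => w k i
  have hWY : W * Y = Wm := by
    ext i k
    have := congrFun (hy k) i
    simp only [mulVec, dotProduct] at this
    simp only [mul_apply, Y, Wm, ← this]
  -- `det Wm ≠ 0` (the `w_k` are independent over `ℝ`)
  set Wmr : Matrix (Fin N) (Fin N) ℝ := Wm.map (Int.cast : ℤ → ℝ) with hWmr
  have hWmrdet : Wmr.det = (Wm.det : ℝ) := by rw [hWmr, Int.cast_det]
  have hcols : (fun k => castVec (w k)) = Wmr.col := by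
    funext k; ext i; simp [castVec, Wmr, Wm, Matrix.col, Matrix.map_apply]
  have hWmr0 : Wmr.det ≠ 0 := by
    have hunit : IsUnit Wmr := Matrix.linearIndependent_cols_iff_isUnit.mp (hcols ▸ hli)
    exact ((Matrix.isUnit_iff_isUnit_det _).mp hunit).ne_zero
  have hYdet : Y.det ≠ 0 := by
    intro h
    apply hWmr0
    rw [hWmrdet, ← hWY, det_mul, h, mul_zero, Int.cast_zero]
  -- `[ℤ^N : Λ] = |det W| ≤ |det W| |det Y| = |det Wm|`
  have hZ : (Λ.index : ℤ) ≤ |Wm.det| := by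
    rw [← hWdet, Int.natCast_natAbs, ← hWY, det_mul, abs_mul]
    have h1 : 1 ≤ |Y.det| := Int.one_le_abs hYdet
    nlinarith [abs_nonneg W.det]
  have hindex : (Λ.index : ℝ) ≤ |Wmr.det| := by
    rw [hWmrdet, ← Int.cast_abs]
    exact_mod_cast hZ
  -- conclude with the permutation expansion
  have hexp := abs_det_mul_le_factorial_mul_prod A Wmr
  have hcol : ∀ k, (fun i => Wmr i k) = castVec (w k) := fun k => by
    ext i; simp [castVec, Wmr, Wm, Matrix.map_apply]
  simp only [hcol] at hexp
  rw [det_mul, abs_mul] at hexp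
  calc |A.det| * Λ.index ≤ |A.det| * |Wmr.det| :=
        mul_le_mul_of_nonneg_left hindex (abs_nonneg _)
    _ ≤ N.factorial * ∏ k, ‖A *ᵥ castVec (w k)‖ := hexp

/-! ### The span of the small lattice points and the rank (B–G Definition 7.5.11) -/

/-- The lattice points of `Λ` in the parallelepiped `{‖A ξ‖ ≤ 1}`, as real vectors: for `K = ℚ`
these are the `x` with `ι(x) ∈ Π(Q)` of B–G. [cite: BombieriGubler2006, Definition 7.5.11] -/
def smallSet (A : Matrix (Fin N) (Fin N) ℝ) (Λ : AddSubgroup (Fin N → ℤ)) : Set (Fin N → ℝ) :=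
  {ξ | ∃ z ∈ Λ, ‖A *ᵥ castVec z‖ ≤ 1 ∧ castVec z = ξ}

/-- Membership in `smallSet`. [folklore] -/
theorem mem_smallSet {A : Matrix (Fin N) (Fin N) ℝ} {Λ : AddSubgroup (Fin N → ℤ)}
    {ξ : Fin N → ℝ} : ξ ∈ smallSet A Λ ↔ ∃ z ∈ Λ, ‖A *ᵥ castVec z‖ ≤ 1 ∧ castVec z = ξ :=
  Iff.rfl

/-- A small lattice point lies in `smallSet`. [folklore] -/
theorem castVec_mem_smallSet {A : Matrix (Fin N) (Fin N) ℝ} {Λ : AddSubgroup (Fin N → ℤ)}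
    {z : Fin N → ℤ} (hz : z ∈ Λ) (h : ‖A *ᵥ castVec z‖ ≤ 1) : castVec z ∈ smallSet A Λ :=
  ⟨z, hz, h, rfl⟩

/-- **B–G's `V(Q)`** for `K = ℚ`: the real span of the lattice points of `Λ` lying in the
parallelepiped `{‖A ξ‖ ≤ 1}`. [cite: BombieriGubler2006, Definition 7.5.11] -/
def VSpan (A : Matrix (Fin N) (Fin N) ℝ) (Λ : AddSubgroup (Fin N → ℤ)) :
    Submodule ℝ (Fin N → ℝ) :=
  Submodule.span ℝ (smallSet A Λ)

/-- Unfolding lemma for `VSpan`. [folklore] -/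
theorem VSpan_def (A : Matrix (Fin N) (Fin N) ℝ) (Λ : AddSubgroup (Fin N → ℤ)) :
    VSpan A Λ = Submodule.span ℝ (smallSet A Λ) := rfl

/-- For a directional system the set of indices `k` with `‖A v_k‖ ≤ 1` is an initial segment.
[folklore] -/
theorem small_index_iff_lt_card {v : Fin N → Fin N → ℤ} {A : Matrix (Fin N) (Fin N) ℝ}
    (hmono : Monotone (fun k => ‖A *ᵥ castVec (v k)‖)) (k : Fin N) :
    ‖A *ᵥ castVec (v k)‖ ≤ 1 ↔
      (k : ℕ) < (Finset.univ.filter fun l : Fin N => ‖A *ᵥ castVec (v l)‖ ≤ 1).card := by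
  classical
  set T := Finset.univ.filter fun l : Fin N => ‖A *ᵥ castVec (v l)‖ ≤ 1 with hT
  -- `T` is down-closed, hence `T = {l | l < #T}`
  have hdown : ∀ l k : Fin N, l ≤ k → k ∈ T → l ∈ T := by
    intro l k hlk hk
    simp only [hT, Finset.mem_filter, Finset.mem_univ, true_and] at hk ⊢
    exact (hmono hlk).trans hk
  have hTeq : T = Finset.univ.filter fun l : Fin N => (l : ℕ) < T.card := by
    -- both are down-closed initial segments of the same cardinality
    have hsub : ∀ k ∈ T, (k : ℕ) < T.card := by
      intro k hk
      have : (Finset.univ.filter fun l : Fin N => l ≤ k) ⊆ T := by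
        intro l hl
        simp only [Finset.mem_filter, Finset.mem_univ, true_and] at hl
        exact hdown l k hl hk
      have hcard := Finset.card_le_card this
      have : (Finset.univ.filter fun l : Fin N => l ≤ k).card = (k : ℕ) + 1 := by
        have : (Finset.univ.filter fun l : Fin N => l ≤ k) = Finset.Iic k := by
          ext l; simp
        rw [this, Fin.card_Iic]
      omega
    apply Finset.eq_of_subset_of_card_le
    · intro k hk
      simp only [Finset.mem_filter, Finset.mem_univ, true_and]
      exact hsub k hk
    · have hle : T.card ≤ N := by
        simpa using Finset.card_le_univ T
      have : (Finset.univ.filter fun l : Fin N => (l : ℕ) < T.card).card = T.card := by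
        rw [Fin.card_filter_val_lt]
        omega
      omega
  constructor
  · intro hk
    have : k ∈ T := by simp [hT, hk]
    rw [hTeq] at this
    simpa using this
  · intro hk
    have : k ∈ T := by
      rw [hTeq]; simpa using hk
    simpa [hT] using this

/-- **Rank and `V(Q)` from a directional system** (B–G, proof of Lemma 7.5.12): if
`v₀, …, v_{N-1}` is a directional system of `(‖A ·‖, Λ)` and `r` is the number of `k` with
`‖A v_k‖ ≤ 1`, then `V = span_ℝ(v₀, …, v_{r-1})`: every lattice point in the parallelepiped lies
in the span of the `v_k` with `‖A v_k‖ ≤ 1`. [cite: BombieriGubler2006, Lemma 7.5.12 (proof)] -/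
theorem VSpan_eq_span_of_directional {A : Matrix (Fin N) (Fin N) ℝ} {Λ : AddSubgroup (Fin N → ℤ)}
    {v : Fin N → Fin N → ℤ} (hv : ∀ k, v k ∈ Λ)
    (hli : LinearIndependent ℝ (fun k => castVec (v k)))
    (hmono : Monotone (fun k => ‖A *ᵥ castVec (v k)‖))
    (hdir : ∀ k : Fin N, ∀ z ∈ Λ, ‖A *ᵥ castVec z‖ < ‖A *ᵥ castVec (v k)‖ →
      castVec z ∈ Submodule.span ℝ ((fun k => castVec (v k)) '' {l | l < k})) :
    VSpan A Λ = Submodule.span ℝ ((fun k => castVec (v k)) '' {k | ‖A *ᵥ castVec (v k)‖ ≤ 1}) := by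
  classical
  apply le_antisymm
  · rw [VSpan_def, Submodule.span_le]
    rintro ξ ⟨z, hz, hsmall, rfl⟩
    set T := Finset.univ.filter fun l : Fin N => ‖A *ᵥ castVec (v l)‖ ≤ 1 with hT
    by_cases hr : T.card < N
    · -- `‖A v_r‖ > 1 ≥ ‖A z‖`, so `z ∈ span(v_l : l < r) ⊆ span(small v_k)`
      let r : Fin N := ⟨T.card, hr⟩
      have hr1 : ¬ ‖A *ᵥ castVec (v r)‖ ≤ 1 := by
        rw [small_index_iff_lt_card hmono r, ← hT]
        simp [r]
      have hlt : ‖A *ᵥ castVec z‖ < ‖A *ᵥ castVec (v r)‖ := lt_of_le_of_lt hsmall (not_le.mp hr1)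
      have hmem := hdir r z hz hlt
      refine Submodule.span_mono ?_ hmem
      rintro _ ⟨l, hl, rfl⟩
      refine ⟨l, ?_, rfl⟩
      simp only [Set.mem_setOf_eq] at hl ⊢
      rw [small_index_iff_lt_card hmono l, ← hT]
      exact Fin.lt_def.mp hl
    · -- all `v_k` are small and independent: their span is everything
      have hall : ∀ k : Fin N, ‖A *ᵥ castVec (v k)‖ ≤ 1 := by
        intro k
        rw [small_index_iff_lt_card hmono k, ← hT]
        have := k.2
        omega
      have himg : (fun k => castVec (v k)) '' {k | ‖A *ᵥ castVec (v k)‖ ≤ 1} =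
          Set.range fun k => castVec (v k) := by
        ext ξ
        constructor
        · rintro ⟨k, _, rfl⟩; exact ⟨k, rfl⟩
        · rintro ⟨k, rfl⟩; exact ⟨k, hall k, rfl⟩
      rw [himg, hli.span_eq_top_of_card_eq_finrank' (by simp)]
      exact Submodule.mem_top
  · rw [VSpan_def]
    refine Submodule.span_mono ?_
    rintro _ ⟨k, hk, rfl⟩
    exact ⟨v k, hv k, hk, rfl⟩

/-- **The rank** (B–G Definition 7.5.11) from a directional system: `dim V` is the number `r` of
indices `k` with `‖A v_k‖ ≤ 1`. [cite: BombieriGubler2006, Definition 7.5.11] -/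
theorem finrank_VSpan_of_directional {A : Matrix (Fin N) (Fin N) ℝ} {Λ : AddSubgroup (Fin N → ℤ)}
    {v : Fin N → Fin N → ℤ} (hv : ∀ k, v k ∈ Λ)
    (hli : LinearIndependent ℝ (fun k => castVec (v k)))
    (hmono : Monotone (fun k => ‖A *ᵥ castVec (v k)‖))
    (hdir : ∀ k : Fin N, ∀ z ∈ Λ, ‖A *ᵥ castVec z‖ < ‖A *ᵥ castVec (v k)‖ →
      castVec z ∈ Submodule.span ℝ ((fun k => castVec (v k)) '' {l | l < k})) :
    finrank ℝ (VSpan A Λ) =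
      (Finset.univ.filter fun l : Fin N => ‖A *ᵥ castVec (v l)‖ ≤ 1).card := by
  classical
  rw [VSpan_eq_span_of_directional hv hli hmono hdir]
  set s : Set (Fin N) := {k | ‖A *ᵥ castVec (v k)‖ ≤ 1} with hs
  have hrange : (fun k => castVec (v k)) '' s = Set.range (fun k : s => castVec (v k)) := by
    ext ξ; simp [hs]
  have hli' : LinearIndependent ℝ (fun k : s => castVec (v k)) :=
    hli.comp (fun k : s => (k : Fin N)) Subtype.val_injective
  rw [hrange, finrank_span_eq_card hli', Fintype.card_ofFinset]
  congr 1

end Literature.NumberTheory.DiophantineApproximation.Subspace
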